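import Summits.Ventures.GridStability.Models.NE39SP
import Summits.Ventures.GridStability.Models.StructurePreservingBridge
import Literature.MathematicalPhysics.PowerSystems.StructurePreservingNormalOperationStability
import HarnessLib

/-!
# GridStability/Models/NE39SPOperatingPointStable (statements + proofs by gridfusion-lit-1 g12, template
# fee0784d556cc738; filed UNCHANGED but for this header by gridfusion-model-7 g7 per lead g10 RULING 9ds (3),
# 2026-08-28, as the ★★ token «#126‴ NE39SP-LES-BY-COR1», second route, no count): the operating point `δ₀`
# of the 49-node STRUCTURE-PRESERVING New England record is a LOCALLY EXPONENTIALLY STABLE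
# synchronous solution of the structure-preserving model, for EVERY damping / load-frequency vector
# `D > 0` — Manik–Timme–Witthaut 2017 Cor. 1 («normal operation on a connected network ⇒ stable»),
# census-free, solver-free, on a MESHED 39-bus network

Ingredients (all on tree): `Models/NE39SP.lean` (model-2/model-4: record `params D`, `b`, `δ₀`,
`parentV`, `depthV`, `treeEdge`, `b_symm`, `b_nonneg`, `wt_pos`, `window`, `theta_nonneg`,
`theta_lt_pi_div_two`, `isSyncEquilibrium`), `Models/StructurePreservingBridge.lean`
(`Params.toBergenHill`), lit-1 `Literature/…/StructurePreservingNormalOperationStability.lean`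
(p588700: `BergenHill.syncSolution_locally_expStable_of_normalOperation`,
`ClassicalModel.couplingConnected_of_rootedTree` through `NormalOperationStability.lean`) over lit-2's
`StructurePreservingSyncExponentialStability.lean` (spectral route: Lyapunov's indirect method in the
rotation-quotient form). [cite: ManikTimmeWitthaut2017, §3 Cor. 1 and Lemma 1; DorflerChertkovBullo2013,
SI §3.1 Lemma 1 (ii), Lemma 2 (2); Padiyar2013, §3.2 eqs (3.2)–(3.5), App. D].
THREE COLUMNS: CERTIFIED for MODEL MV-3 record NE39-SP49 (column LF, tokens of `NE39SP.lean`),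
EVERY `D > 0`: the coupling graph is connected (BFS tree of positive couplings), the operating point
`δ₀` is in normal operation (every coupled pair has `|δ₀ᵢ − δ₀ⱼ| ≤ θ = 2·arctan τ_max < π/2`, hence
positive cosine), and therefore `δ₀` is a LOCALLY EXPONENTIALLY STABLE synchronous solution of the
structure-preserving model modulo the uniform rotation (∃ ρ, k, λ > 0: every forward solution with
`‖(δ(0) − δ₀, v_G(0) − ω₀𝟙)‖ < ρ` has `‖(δ(t) − ω₀t𝟙 − (δ₀ + c𝟙), v_G(t) − ω₀𝟙)‖ ≤ k‖…(0)‖e^{−λt}`;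
`ω₀ = 0` here since `P⁰ := f(δ₀)`); VALIDATED nothing numerical (ρ, k, λ existential; no rate is
claimed); MODELLED as the record — «stable» = the synchronous solution of MODEL M, never the New
England system.
-/

noncomputable section

open Real Set Filter Topology Finset

namespace Summit.Ventures.GridStability.Models.NE39SP

open StructurePreserving StructurePreserving.Params
open Literature.MathematicalPhysics.PowerSystems
open Literature.MathematicalPhysics.PowerSystems.ClassicalModel

/-- Depth bookkeeping of the BFS tree of block (d): every non-root node is one level below its
parent. -/
theorem depthV_parentV : ∀ i : Fin 49, i ≠ 39 → depthV i = depthV (parentV i) + 1 := by decide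

/-- The tree edges are live: `b_{i, parent i} ≠ 0` (it is the listed weight `wt (treeEdge i) > 0`). -/
theorem b_parentV_ne_zero : ∀ i : Fin 49, i ≠ 39 → b i (parentV i) ≠ 0 := by
  intro i hi
  refine symmetrize_edgeWeight_ne_zero_of_edge wt_nonneg (treeEdge i) (wt_pos _) ?_
  exact (by decide : ∀ v : Fin 49, v ≠ 39 →
    (srcV (treeEdge v) = v ∧ tgtV (treeEdge v) = parentV v)
      ∨ (srcV (treeEdge v) = parentV v ∧ tgtV (treeEdge v) = v)) i hi

/-- The tree edges have POSITIVE coupling. -/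
theorem b_parentV_pos : ∀ i : Fin 49, i ≠ 39 → 0 < b i (parentV i) := fun i hi =>
  lt_of_le_of_ne (b_nonneg _ _) (b_parentV_ne_zero i hi).symm

/-- **The coupling graph of the record is CONNECTED** (cut form `CouplingConnected`): the BFS tree
of block (d) is a rooted spanning tree of positive couplings
(`ClassicalModel.couplingConnected_of_rootedTree`). -/
theorem couplingConnected : ClassicalModel.CouplingConnected b :=
  ClassicalModel.couplingConnected_of_rootedTree (root := (39 : Fin 49)) depthV_parentV b_symm
    b_parentV_pos

/-- Inertia constants are nonnegative (zero at the buses, positive at the machines). -/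
theorem M_nonneg (D : Fin 49 → ℝ) : ∀ i, 0 ≤ (params D).toBergenHill.M i := by
  intro i
  change (0 : ℝ) ≤ ((MQ i : ℚ) : ℝ)
  have : (0 : ℚ) ≤ MQ i := by fin_cases i <;> norm_num [MQ]
  exact_mod_cast this

/-- `δ₀` is a synchronous state of the Literature record (`flow δ₀ = P̄`; `ω₀ = 0` here). -/
theorem δ₀_sync (D : Fin 49 → ℝ) :
    ∀ k, (params D).toBergenHill.flow δ₀ k = (params D).toBergenHill.shiftedInjection k :=
  fun k => isSyncEquilibrium D k

/-- **NORMAL OPERATION at the operating point**: every coupled pair has `|δ₀ᵢ − δ₀ⱼ| ≤ θ < π/2`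
(`window`, `theta_lt_pi_div_two`), hence positive cosine. -/
theorem δ₀_normalOperation (D : Fin 49 → ℝ) :
    ∀ i j, i ≠ j → 0 < (params D).toBergenHill.b i j → 0 < Real.cos (δ₀ i - δ₀ j) := by
  intro i j _ hb
  have hb' : (params D).b i j ≠ 0 := ne_of_gt hb
  have hw := window D i j hb'
  have hθ := theta_lt_pi_div_two
  have hθ0 := theta_nonneg
  exact Real.cos_pos_of_mem_Ioo ⟨by linarith [(abs_le.mp hw).1], by linarith [(abs_le.mp hw).2]⟩

/-- ★ **THE OPERATING POINT `δ₀` OF THE NE39-SP RECORD IS A LOCALLY EXPONENTIALLY STABLE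
SYNCHRONOUS SOLUTION OF THE STRUCTURE-PRESERVING MODEL, FOR EVERY `D > 0`** (MODEL MV-3, record
NE39-SP49 column LF; modulo the uniform rotation): `∃ ρ, k, λ > 0` such that every forward solution
`(δ, v)` of the Bergen–Hill equations of `params D` with `‖(δ(0) − δ₀, v_G(0) − ω₀𝟙)‖ < ρ` satisfies
`‖(δ(t) − ω₀t𝟙 − (δ₀ + c𝟙), v_G(t) − ω₀𝟙)‖ ≤ k‖(δ(0) − (δ₀ + c𝟙), v_G(0) − ω₀𝟙)‖e^{−λt}` for `t ≥ 0`,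
`c = (Σ Dᵢ(δᵢ(0) − δ₀ᵢ) + Σ_{gen} Mᵢ(vᵢ(0) − ω₀))/Σ Dᵢ`, `ω₀ = syncFrequency` (`= 0` here) — Manik–Timme–
Witthaut's Cor. 1 («Consider a simply connected network. A fixed point θ* is transversally
asymptotically stable if cos(θ*ᵢ − θ*ⱼ) > 0 holds for all edges») on a MESHED 49-node record, census-
free and solver-free (`BergenHill.syncSolution_locally_expStable_of_normalOperation`). -/
theorem δ₀_syncSolution_locally_expStable {D : Fin 49 → ℝ} (hD : ∀ i, 0 < D i) :
    ∃ ρ > 0, ∃ k > 0, ∃ lam > 0, ∀ δ v : ℝ → Fin 49 → ℝ,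
      (∀ t, 0 ≤ t → (params D).toBergenHill.IsSolutionAt δ v t) →
      ‖(params D).toBergenHill.phase (δ 0 - δ₀)
          (fun g => v 0 g.1 - (params D).toBergenHill.syncFrequency)‖ < ρ →
      ∀ t : ℝ, 0 ≤ t →
        ‖(params D).toBergenHill.phase (fun i => δ t i - (params D).toBergenHill.syncFrequency * t
              - (δ₀ i + (∑ j, (params D).toBergenHill.D j * (δ 0 j - δ₀ j)
                  + ∑ g : (params D).toBergenHill.Gen, (params D).toBergenHill.M g.1
                      * (v 0 g.1 - (params D).toBergenHill.syncFrequency))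
                    / ∑ j, (params D).toBergenHill.D j))
            (fun g => v t g.1 - (params D).toBergenHill.syncFrequency)‖
          ≤ k * ‖(params D).toBergenHill.phase (fun i => δ 0 i
              - (δ₀ i + (∑ j, (params D).toBergenHill.D j * (δ 0 j - δ₀ j)
                  + ∑ g : (params D).toBergenHill.Gen, (params D).toBergenHill.M g.1
                      * (v 0 g.1 - (params D).toBergenHill.syncFrequency))
                    / ∑ j, (params D).toBergenHill.D j))
            (fun g => v 0 g.1 - (params D).toBergenHill.syncFrequency)‖ * Real.exp (-lam * t) :=
  BergenHill.syncSolution_locally_expStable_of_normalOperation (S := (params D).toBergenHill)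
    (M_nonneg D) hD (fun i j => b_symm i j) (fun i j _ => b_nonneg i j) couplingConnected
    (δ₀_sync D) (δ₀_normalOperation D)

end Summit.Ventures.GridStability.Models.NE39SP

end
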